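import Summits.Ventures.AbcSig.Rows.TemplateC2a
import Summits.Ventures.AbcSig.Levels.N22
import Summits.Ventures.AbcSig.Levels.N44
import Summits.Ventures.AbcSig.Levels.N88

/-!
# Venture AbcSig — ROW `C2aL11A2`: `xⁿ + 2^a·11^m·yⁿ = z²`, class `a 2` (GENERATED by plean/leanrow.py)

HONEST FRAMING. A row of a COMPUTATION cell (`pub-abcsig`); a CONDITIONAL theorem, no claim on ABC or any summit.
Hypotheses: `BS04Package` (CITED), `DataComplete` at levels [22, 44, 88] (COMPUTED, two-engine certified
level files), and the listed per-orbit exclusions `hX_…` (CITED — e.g. the cell's M6 Eisenstein certificates; the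
row's R5 cell names each). Everything else is kernel-checked (`Rows/TemplateC2a.lean`, `Levels/N….lean`). Exponent
range: prime `n ≥ 11`, `n ≠ 11`; `B = 2^a 11^m` with `a, m < n` (n-th-power free).
Row of record:  (sha256 ; SIGNED 2026-08-22T08:50:29Z by referee (ref-g4)); its R0: THEOREM (sieve-complete) for all primes n >= 11 with n coprime to 44 — class: REPRODUCTION candidate (AB = 4·11^m cell of BS04 Thm 1.3's second list). Exponents left open by the row of record are excluded here via ; kernel-sieve residuals the row of record closes by a cell module (M6 Eisenstein / M4 Kraus certificates) appear as CITED hypotheses .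
-/

namespace Summit.Ventures.AbcSig

/-- Row `C2aL11A2` (see module docstring). -/
theorem row_C2aL11A2 (M : NewformModel) (hP : M.BS04Package)
    (hD22 : M.DataComplete 22 level22Orbits) (hD44 : M.DataComplete 44 level44Orbits) (hD88 : M.DataComplete 88 level88Orbits)
    (n : ℕ) (hn : n.Prime) (hmin : 11 ≤ n) (hnℓ : n ≠ 11) (m : ℕ) (hm : 1 ≤ m) (hmn : m < n)
    
    (x y z : ℤ) (hxy1 : x * y ≠ 1) (hxy2 : x * y ≠ -1) : ¬ IsPrimitiveSolution 1 (2 ^ 2 * 11 ^ m) 1 n x y z := by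
  have hℓ : Nat.Prime 11 := by norm_num
  have h7 : 7 ≤ n := by omega
  have hS22 :=
    (level22_sieve n hn h7 (fun o => M.Excludes 22 o (famB (2 ^ 2 * 11 ^ m) n (fun _ _ => True))))
  have hS44 :=
    (level44_sieve n hn h7 (fun o => M.Excludes 44 o (famB (2 ^ 2 * 11 ^ m) n (fun _ _ => True))))
  have hS88 :=
    (level88_sieve n hn h7 (fun o => M.Excludes 88 o (famB (2 ^ 2 * 11 ^ m) n (fun _ _ => True))) (fun h => absurd h (by simp only [List.mem_cons, List.not_mem_nil, or_false]; omega)))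
  exact rowC2a_a2 11 hℓ (by norm_num) M hP n hn h7 hnℓ hD44 hD88 hD22 m hm hmn
    hS44
    hS88
    hS22 x y z hxy1 hxy2

end Summit.Ventures.AbcSig
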